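/-
Copyright (c) 2026 the pub-hodgecm-mathlib formalisation cell (harness21).  Prover seat hodgecm-mathlib-B-p14 (g40), 2026-09-02.  «S3-ram» seeding wave (LEAD F0P3a-plan (g13);
owner F0P3a-p06 (g15)); (Cnt2′) chair F0P3a-p07 (g14) RULING (5) 02:25:51Z, organ **(z5) «SIGN LAW»** for the type-(2) rows `0` ∕ `1±` (ROADMAP v1.1 c4a02a78 §1′).
-/
import Literature.NumberTheory.Automorphic.HeisenbergLevelTwoStrataSplitRamified                  -- ★ `ringChar_residueField_ne_two` (`|2|_w = 1 ⇒ char 𝓀_w ≠ 2`)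
import Literature.NumberTheory.Rogawski1990.DepthZeroKappaTransferTypeOneRamifiedSignDictionary   -- ★ p847416 (this seat's lineage, g39): §1 `v_symmDisc_sub_one_lt_one`, §2 `isSquare_residue_iff_exists_norm_of_fixed_of_ramified`; brings ★ `hilbertSymbol_eq_one_iff_exists_norm_toPlace`
import HarnessLib

/-!
# (z5) THE SIGN LAW at a tame-ramified place: `(y, θ)_v = χ((−1)^m · η̄)` for `ι_w y = η·ϖ_w^{2m}`, and the type-(2) reading `(β(γ_H), θ)_v = χ((−1)^{m+1} · c̄₀)`,
# `c₀` the unit part of `χ_g(u)_w`, `m = v_F(χ_g(u))` (Serre, *Local Fields* V §3, XIV §3; O'Meara §63B; Rogawski 1990 §4.9; Labesse–Langlands 1979 §2)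

Topic `NumberTheory/Rogawski1990`; namespace `Literature.NumberTheory.Rogawski1990`.  THEOREMS ONLY (no definition, no instance, no notation, no named fact, no `sorry`);
kernel lane `--supports stmt-HodgeConjecture-24833`.  Cell `pub/hodgecm-mathlib` (D-0151), crux H413; road «S3-ram», fold v7.8 sockets `stub_typeTwo_counts_{even,odd}_ram`
← chair skeleton v2 rows `stub_T2G_{zero,pm}_{even,odd}_ram`.  ROADMAP v1.1 §1′: each row is EQUIVALENT to one INTRINSIC LAW `S_j(t₀) − S_j(t₁) = (β,θ)_v · q^m · X̃_j(n)`
with `ι_w β = −χ_g(u)_w·(u_w² + det g_w)∕(2u_w² det g_w)` (T5 symmetrised discriminant; ★ (F) `exists_norm_mul_favourableClass_eq_one_iff_hilbertSymbol_mul_eq_one`), and the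
sign `(β,θ)_v` must be READ ON THE LATTICE ANATOMY, i.e. on residues of the (T2) data.  THIS FILE is that dictionary.  HONEST LABEL: HC_CM is proved only modulo the cell's
2 remaining named inputs (hLiu418 24832, h413 24833) until rung 0 closes; unconditional local algebra at one place, count-neutral.

FRAME (= ★ p847416 ∕ ★ (F)): `L ∕ L⁺` CM, `w ∣ v` non-split TAMELY RAMIFIED (`e(w|v) ≠ 1`, `|2|_w = 1`), `σ = σ_w`, `ϖ` an anti-fixed uniformiser (`σϖ = −ϖ`), `𝓀 = 𝓀_w`,
`θ = cmQuadraticGenerator L`, `(·,θ)_v` the Hilbert symbol of `L⁺_v` (= the norm-residue character, ★ `hilbertSymbol_eq_one_iff_exists_norm_toPlace`), `χ = quadraticChar 𝓀`,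
`res = IsLocalRing.residue 𝒪_w`.  Every `σ`-fixed non-zero element has EVEN `w`-order (★ `LocalFields/RamifiedPlaceNormDictionary`), so `ι_w y = η·ϖ^{2m}` is the general shape.
* §0 `exists_mul_norm_mul_eq_one_iff_exists_norm_eq` — the socket's FAV shape `∃ z, z·σz·X = 1` is `X ∈ N(L_w^×)`.
* §1 **THE CORE** `exists_norm_eq_mul_pow_iff_isSquare_residue_of_ramified` (`η·ϖ^{2m} ∈ N ⟺ res((−1)^m η) ∈ 𝓀²`: `η ϖ^{2m} = N(ϖ^m)·(−1)^m η`, `N(ϖ^m) = (−1)^m ϖ^{2m}`, then ★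
  g39 §2 on the fixed unit `(−1)^m η`), **`quadraticChar_residue_eq_hilbertSymbol_of_toPlace_eq_mul_pow`** (`χ((−1)^m η̄) = (y,θ)_v`), the `↔`-readings and the FAV reading.
* §2 «q mod 4»: **`hilbertSymbol_eq_chi4_pow_mul_quadraticChar_of_toPlace_eq_mul_pow`** (`(y,θ)_v = χ₄(#𝓀)^m · χ(η̄)`, Mathlib `quadraticChar_neg_one` + ★ `ringChar_residueField_ne_two`).
* §3 **THE TYPE-(2) HEAD `quadraticChar_residue_eq_hilbertSymbol_typeTwo_of_ramified`**: `u ≡ 1`, `d = det g_w ≡ 1`, `c = χ_g(u)_w = c₀·ϖ^{2m}` (`c₀` a unit) and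
  `ι_w β = −c(u²+d)∕(2u²d)` ⇒ **`χ((−1)^{m+1}·c̄₀) = (β,θ)_v`** (the correction `(u²+d)∕(2u²d)` is a 1-unit, ★ g39 §1 at `(α,γ) := (d,1)`); `↔`-readings, ℂ twin, χ₄ twin.
ENGINE CERTIFICATE (B-p14 (g40) `signlaw_cert.py` 4cdb2d5b over the g38 P2ram engine; `CERT-signlaw-ledger` 5d079442, `CERT-signlaw-sweep` bce63b8d): §3's `χ((−1)^{m+1} c̄₀)` =
the engine's `τ = ω_E(−χ_g(u)∕det g)` = LEDGER `fav` on 20∕20 LEDGER rows and = `τ` on 288∕288 sweep rows (q ∈ {3,5,7,11}, N ≤ 7, k_u ≤ 3).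

## References
* [Serre1979] J.-P. Serre, *Local Fields*, GTM 67 (1979): Ch. V §3 Cor. 2 (tame quadratic: unit norms = residue squares), Ch. XIV §3 (the symbol `(a,b)_v`, Prop. 8: tame case).
* [Omeara1963] O. T. O'Meara, *Introduction to Quadratic Forms* (1963): §63B (63:11a, 63:13a).
* [Rogawski1990] J. D. Rogawski, *Automorphic Representations of Unitary Groups in Three Variables*, Ann. of Math. Stud. 123 (1990): §4.9 Prop. 4.9.1 p. 55, p. 59 (the sign `τ`).
* [LabesseLanglands1979] J.-P. Labesse, R. P. Langlands, *L-indistinguishability for SL(2)*, Canad. J. Math. 31 (1979): §2 pp. 8–9.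
-/

set_option autoImplicit false

noncomputable section

open NumberField IsDedekindDomain ValuativeRel
open Literature.NumberTheory.Automorphic Literature.NumberTheory.Automorphic.UnitaryGroup Literature.NumberTheory.QuadraticForms
open scoped ValuativeRel

namespace Literature.NumberTheory.Rogawski1990

section SignLaw

variable (L : Type) [Field L] [NumberField L] [IsCMField L] {v : HeightOneSpectrum (𝓞 ↥(maximalRealSubfield L))}
  (w : PlacesOver L v) (hw : IsCMField.complexConj L • w.1 = w.1)

/-! ## §0 The FAV shape `∃ z, z·σz·X = 1` is the norm shape -/

/-- For `X ≠ 0`: `(∃ z, z·σ_w z·X = 1) ↔ (∃ z, σ_w z·z = X)` (`z ↦ z⁻¹`). [cite: Omeara1963, §63B] -/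
theorem exists_mul_norm_mul_eq_one_iff_exists_norm_eq {X : w.1.adicCompletion L} (hX : X ≠ 0) :
    (∃ z : w.1.adicCompletion L, z * galAdicCompletionMap (L := L) (IsCMField.complexConj L) hw z * X = 1) ↔
      ∃ z : w.1.adicCompletion L, galAdicCompletionMap (L := L) (IsCMField.complexConj L) hw z * z = X := by
  constructor
  · rintro ⟨z, hz⟩
    have hz0 : z ≠ 0 := fun h => by rw [h, zero_mul, zero_mul] at hz; exact zero_ne_one hz
    refine ⟨z⁻¹, ?_⟩
    have hzz : z * galAdicCompletionMap (L := L) (IsCMField.complexConj L) hw z ≠ 0 := fun h => by rw [h, zero_mul] at hz; exact zero_ne_one hz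
    rw [map_inv₀, ← mul_inv, mul_comm]
    exact inv_eq_of_mul_eq_one_right hz
  · rintro ⟨z, hz⟩
    have hz0 : z ≠ 0 := fun h => by rw [h, mul_zero] at hz; exact hX hz.symm
    have hσz0 : galAdicCompletionMap (L := L) (IsCMField.complexConj L) hw z ≠ 0 := fun h => by rw [h, zero_mul] at hz; exact hX hz.symm
    refine ⟨z⁻¹, ?_⟩
    rw [map_inv₀, ← hz]; field_simp

/-! ## §1 The core: elements of even order `η·ϖ^{2m}` -/

include hw in
/-- **THE CORE, NORM FORM**: for a `σ_w`-fixed unit `η` and `m ∈ ℕ`, **`η·ϖ^{2m} ∈ N(L_w^×) ⟺ res((−1)^m·η) ∈ 𝓀_w²`** — since `η·ϖ^{2m} = N(ϖ^m)·((−1)^m η)` with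
`N(ϖ^m) = σ(ϖ^m)·ϖ^m = (−1)^m ϖ^{2m}` a norm, and a fixed unit is a norm iff its residue is a square (★ `isSquare_residue_iff_exists_norm_of_fixed_of_ramified`).
[cite: Serre1979, Ch. V §3 Cor. 2] [cite: Omeara1963, §63B 63:11a] -/
theorem exists_norm_eq_mul_pow_iff_isSquare_residue_of_ramified (he : v.asIdeal.ramificationIdx' w.1.asIdeal ≠ 1) (h2 : Valued.v (2 : w.1.adicCompletion L) = 1)
    (ϖ : w.1.adicCompletion L) (hϖ : Valued.v ϖ = WithZero.exp (-1 : ℤ)) (hσϖ : galAdicCompletionMap (L := L) (IsCMField.complexConj L) hw ϖ = -ϖ)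
    (η : 𝒪[w.1.adicCompletion L]) (hηv : Valued.v (η : w.1.adicCompletion L) = 1)
    (hση : galAdicCompletionMap (L := L) (IsCMField.complexConj L) hw (η : w.1.adicCompletion L) = η) (m : ℕ) :
    (∃ z : w.1.adicCompletion L, galAdicCompletionMap (L := L) (IsCMField.complexConj L) hw z * z = (η : w.1.adicCompletion L) * ϖ ^ (2 * m)) ↔
      IsSquare (IsLocalRing.residue 𝒪[w.1.adicCompletion L] ((-1) ^ m * η)) := by
  have hϖ0 : ϖ ≠ 0 := fun h => by rw [h, Valuation.map_zero] at hϖ; exact WithZero.exp_ne_zero hϖ.symm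
  -- the fixed unit `η' = (−1)^m η`
  have hη'v : Valued.v (((-1) ^ m * η : 𝒪[w.1.adicCompletion L]) : w.1.adicCompletion L) = 1 := by
    push_cast; rw [Valuation.map_mul, Valuation.map_pow, Valuation.map_neg, Valuation.map_one, one_pow, one_mul, hηv]
  have hση' : galAdicCompletionMap (L := L) (IsCMField.complexConj L) hw (((-1) ^ m * η : 𝒪[w.1.adicCompletion L]) : w.1.adicCompletion L) = ((-1) ^ m * η : 𝒪[w.1.adicCompletion L]) := by
    push_cast; rw [map_mul, map_pow, map_neg, map_one, hση]
  -- `N(ϖ^m)·η' = η·ϖ^{2m}`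
  have hN : galAdicCompletionMap (L := L) (IsCMField.complexConj L) hw (ϖ ^ m) * ϖ ^ m = (-1) ^ m * ϖ ^ (2 * m) := by
    rw [map_pow, hσϖ, neg_pow, mul_assoc, ← pow_add, two_mul]
  have hN0 : galAdicCompletionMap (L := L) (IsCMField.complexConj L) hw (ϖ ^ m) * ϖ ^ m ≠ 0 := by
    rw [map_pow, hσϖ]; exact mul_ne_zero (pow_ne_zero _ (neg_ne_zero.2 hϖ0)) (pow_ne_zero _ hϖ0)
  have hfac : (η : w.1.adicCompletion L) * ϖ ^ (2 * m) =
      (galAdicCompletionMap (L := L) (IsCMField.complexConj L) hw (ϖ ^ m) * ϖ ^ m) * (((-1) ^ m * η : 𝒪[w.1.adicCompletion L]) : w.1.adicCompletion L) := by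
    have hee : ((-1 : w.1.adicCompletion L) ^ m) * (-1) ^ m = 1 := by rw [← mul_pow]; simp
    push_cast
    rw [hN, show ((-1 : w.1.adicCompletion L) ^ m * ϖ ^ (2 * m)) * ((-1) ^ m * (η : w.1.adicCompletion L)) =
      (((-1 : w.1.adicCompletion L) ^ m) * (-1) ^ m) * ((η : w.1.adicCompletion L) * ϖ ^ (2 * m)) by ring, hee, one_mul]
  rw [isSquare_residue_iff_exists_norm_of_fixed_of_ramified L w hw he h2 ((-1) ^ m * η) hη'v hση', hfac]
  constructor
  · rintro ⟨z, hz⟩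
    refine ⟨z / ϖ ^ m, ?_⟩
    rw [map_div₀, div_mul_div_comm, hz, mul_div_cancel_left₀ _ hN0]
  · rintro ⟨y, hy⟩
    refine ⟨y * ϖ ^ m, ?_⟩
    rw [map_mul, ← hy]; ring

include hw in
/-- `η := ι_w y ∕ ϖ^{2m}` is `σ_w`-fixed when `y ∈ L⁺_v` (`ι_w y` and `ϖ^{2m} = (ϖ²)^m` are). [cite: Serre1979, Ch. V §3] -/
theorem galAdicCompletionMap_eq_self_of_toPlace_eq_mul_pow (ϖ : w.1.adicCompletion L) (hϖ : Valued.v ϖ = WithZero.exp (-1 : ℤ))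
    (hσϖ : galAdicCompletionMap (L := L) (IsCMField.complexConj L) hw ϖ = -ϖ) {η : w.1.adicCompletion L} {m : ℕ} {y : v.adicCompletion ↥(maximalRealSubfield L)}
    (hy : toPlace v w y = η * ϖ ^ (2 * m)) :
    galAdicCompletionMap (L := L) (IsCMField.complexConj L) hw η = η := by
  have hϖ0 : ϖ ≠ 0 := fun h => by rw [h, Valuation.map_zero] at hϖ; exact WithZero.exp_ne_zero hϖ.symm
  have hfix := galAdicCompletionMap_toPlace (IsCMField.complexConj L) w w hw y
  rw [hy, map_mul, map_pow, hσϖ, Even.neg_pow (even_two_mul m)] at hfix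
  exact mul_right_cancel₀ (pow_ne_zero _ hϖ0) hfix

include hw in
/-- **THE CORE, SYMBOL READING**: for `y ∈ L⁺_v` with `ι_w y = η·ϖ^{2m}`, `η` a unit of `𝒪_w`: **`(y, θ)_v = 1 ⟺ res((−1)^m·η) ∈ 𝓀_w²`**.
[cite: Serre1979, Ch. XIV §3 Prop. 8; Ch. V §3 Cor. 2] [cite: Omeara1963, §63B 63:11a] -/
theorem hilbertSymbol_eq_one_iff_isSquare_residue_of_toPlace_eq_mul_pow (he : v.asIdeal.ramificationIdx' w.1.asIdeal ≠ 1)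
    (h2 : Valued.v (2 : w.1.adicCompletion L) = 1) (ϖ : w.1.adicCompletion L) (hϖ : Valued.v ϖ = WithZero.exp (-1 : ℤ))
    (hσϖ : galAdicCompletionMap (L := L) (IsCMField.complexConj L) hw ϖ = -ϖ)
    (η : 𝒪[w.1.adicCompletion L]) (hηv : Valued.v (η : w.1.adicCompletion L) = 1) (m : ℕ)
    {y : v.adicCompletion ↥(maximalRealSubfield L)} (hy0 : y ≠ 0) (hy : toPlace v w y = (η : w.1.adicCompletion L) * ϖ ^ (2 * m)) :
    hilbertSymbol (v.adicCompletion ↥(maximalRealSubfield L)) y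
        (algebraMap ↥(maximalRealSubfield L) _ ((cmQuadraticGenerator L : 𝓞 ↥(maximalRealSubfield L)) : ↥(maximalRealSubfield L))) = 1 ↔
      IsSquare (IsLocalRing.residue 𝒪[w.1.adicCompletion L] ((-1) ^ m * η)) := by
  rw [hilbertSymbol_eq_one_iff_exists_norm_toPlace L v w hw hy0, hy]
  exact exists_norm_eq_mul_pow_iff_isSquare_residue_of_ramified L w hw he h2 ϖ hϖ hσϖ η hηv
    (galAdicCompletionMap_eq_self_of_toPlace_eq_mul_pow L w hw ϖ hϖ hσϖ hy) m

include hw in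
/-- **THE SIGN LAW (core)**: for `y ∈ L⁺_v` with `ι_w y = η·ϖ^{2m}`, `η` a unit of `𝒪_w`: **`χ((−1)^m·η̄) = (y, θ)_v`** (`χ = quadraticChar 𝓀_w`; both sides are `±1`).
In the model `L_w = ℚ_p(√p)`: `(x, p)_p = (−1∕p)^k·(x₀∕p)` for `x = p^k x₀`. [cite: Serre1979, Ch. XIV §3 Prop. 8; Ch. V §3 Cor. 2] [cite: Omeara1963, §63B 63:13a] -/
theorem quadraticChar_residue_eq_hilbertSymbol_of_toPlace_eq_mul_pow (he : v.asIdeal.ramificationIdx' w.1.asIdeal ≠ 1)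
    (h2 : Valued.v (2 : w.1.adicCompletion L) = 1) (ϖ : w.1.adicCompletion L) (hϖ : Valued.v ϖ = WithZero.exp (-1 : ℤ))
    (hσϖ : galAdicCompletionMap (L := L) (IsCMField.complexConj L) hw ϖ = -ϖ)
    [Fintype 𝓀[w.1.adicCompletion L]] [DecidableEq 𝓀[w.1.adicCompletion L]]
    (η : 𝒪[w.1.adicCompletion L]) (hηv : Valued.v (η : w.1.adicCompletion L) = 1) (m : ℕ)
    {y : v.adicCompletion ↥(maximalRealSubfield L)} (hy0 : y ≠ 0) (hy : toPlace v w y = (η : w.1.adicCompletion L) * ϖ ^ (2 * m)) :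
    (quadraticChar 𝓀[w.1.adicCompletion L] (IsLocalRing.residue 𝒪[w.1.adicCompletion L] ((-1) ^ m * η)) : ℤ) =
      hilbertSymbol (v.adicCompletion ↥(maximalRealSubfield L)) y
        (algebraMap ↥(maximalRealSubfield L) _ ((cmQuadraticGenerator L : 𝓞 ↥(maximalRealSubfield L)) : ↥(maximalRealSubfield L))) := by
  have key := hilbertSymbol_eq_one_iff_isSquare_residue_of_toPlace_eq_mul_pow L w hw he h2 ϖ hϖ hσϖ η hηv m hy0 hy
  have hη'v : Valued.v (((-1) ^ m * η : 𝒪[w.1.adicCompletion L]) : w.1.adicCompletion L) = 1 := by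
    push_cast; rw [Valuation.map_mul, Valuation.map_pow, Valuation.map_neg, Valuation.map_one, one_pow, one_mul, hηv]
  have h0 : IsLocalRing.residue 𝒪[w.1.adicCompletion L] ((-1) ^ m * η) ≠ 0 := by
    rw [Ne, residue_eq_zero_iff_valuation_lt_one, ← v_lt_one_iff_valuation_lt_one, hη'v]; exact lt_irrefl _
  by_cases hsq : IsSquare (IsLocalRing.residue 𝒪[w.1.adicCompletion L] ((-1) ^ m * η))
  · rw [(quadraticChar_one_iff_isSquare h0).2 hsq, key.2 hsq]
  · rw [quadraticChar_neg_one_iff_not_isSquare.2 hsq]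
    rcases hilbertSymbol_eq_one_or_eq_neg_one y
      (algebraMap ↥(maximalRealSubfield L) _ ((cmQuadraticGenerator L : 𝓞 ↥(maximalRealSubfield L)) : ↥(maximalRealSubfield L))) with h | h
    · exact absurd (key.1 h) hsq
    · rw [h]

include hw in
/-- The FAV READING of the core: for `y ∈ L⁺_v` with `ι_w y = η·ϖ^{2m}` (`η` a unit): **`(∃ z, z·σ_w z·ι_w y = 1) ⟺ res((−1)^m·η) ∈ 𝓀_w²`** — the shape of the (Cnt2′)
sockets' `FAV` hypothesis. [cite: Serre1979, Ch. V §3 Cor. 2] [cite: Omeara1963, §63B] -/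
theorem exists_mul_norm_mul_toPlace_eq_one_iff_isSquare_residue (he : v.asIdeal.ramificationIdx' w.1.asIdeal ≠ 1)
    (h2 : Valued.v (2 : w.1.adicCompletion L) = 1) (ϖ : w.1.adicCompletion L) (hϖ : Valued.v ϖ = WithZero.exp (-1 : ℤ))
    (hσϖ : galAdicCompletionMap (L := L) (IsCMField.complexConj L) hw ϖ = -ϖ)
    (η : 𝒪[w.1.adicCompletion L]) (hηv : Valued.v (η : w.1.adicCompletion L) = 1) (m : ℕ)
    {y : v.adicCompletion ↥(maximalRealSubfield L)} (hy : toPlace v w y = (η : w.1.adicCompletion L) * ϖ ^ (2 * m)) :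
    (∃ z : w.1.adicCompletion L, z * galAdicCompletionMap (L := L) (IsCMField.complexConj L) hw z * toPlace v w y = 1) ↔
      IsSquare (IsLocalRing.residue 𝒪[w.1.adicCompletion L] ((-1) ^ m * η)) := by
  have hϖ0 : ϖ ≠ 0 := fun h => by rw [h, Valuation.map_zero] at hϖ; exact WithZero.exp_ne_zero hϖ.symm
  have hη0 : (η : w.1.adicCompletion L) ≠ 0 := fun h => by rw [h, Valuation.map_zero] at hηv; exact zero_ne_one hηv
  have hX : toPlace v w y ≠ 0 := by rw [hy]; exact mul_ne_zero hη0 (pow_ne_zero _ hϖ0)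
  rw [exists_mul_norm_mul_eq_one_iff_exists_norm_eq L w hw hX, hy]
  exact exists_norm_eq_mul_pow_iff_isSquare_residue_of_ramified L w hw he h2 ϖ hϖ hσϖ η hηv
    (galAdicCompletionMap_eq_self_of_toPlace_eq_mul_pow L w hw ϖ hϖ hσϖ hy) m

/-! ## §2 «q mod 4»: `χ(−1) = χ₄(#𝓀_w)` -/

include hw in
/-- **«q mod 4» READING**: for `y ∈ L⁺_v` with `ι_w y = η·ϖ^{2m}` (`η` a unit): **`(y, θ)_v = χ₄(#𝓀_w)^m · χ(η̄)`** (`χ(−1) = χ₄(q)`, Mathlib `quadraticChar_neg_one`; `q = #𝓀_w`).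
[cite: Serre1979, Ch. XIV §3 Prop. 8] [cite: Omeara1963, §63B 63:13a] -/
theorem hilbertSymbol_eq_chi4_pow_mul_quadraticChar_of_toPlace_eq_mul_pow (he : v.asIdeal.ramificationIdx' w.1.asIdeal ≠ 1)
    (h2 : Valued.v (2 : w.1.adicCompletion L) = 1) (ϖ : w.1.adicCompletion L) (hϖ : Valued.v ϖ = WithZero.exp (-1 : ℤ))
    (hσϖ : galAdicCompletionMap (L := L) (IsCMField.complexConj L) hw ϖ = -ϖ)
    [Fintype 𝓀[w.1.adicCompletion L]] [DecidableEq 𝓀[w.1.adicCompletion L]]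
    (η : 𝒪[w.1.adicCompletion L]) (hηv : Valued.v (η : w.1.adicCompletion L) = 1) (m : ℕ)
    {y : v.adicCompletion ↥(maximalRealSubfield L)} (hy0 : y ≠ 0) (hy : toPlace v w y = (η : w.1.adicCompletion L) * ϖ ^ (2 * m)) :
    hilbertSymbol (v.adicCompletion ↥(maximalRealSubfield L)) y
        (algebraMap ↥(maximalRealSubfield L) _ ((cmQuadraticGenerator L : 𝓞 ↥(maximalRealSubfield L)) : ↥(maximalRealSubfield L))) =
      (ZMod.χ₄ (Fintype.card 𝓀[w.1.adicCompletion L])) ^ m * quadraticChar 𝓀[w.1.adicCompletion L] (IsLocalRing.residue 𝒪[w.1.adicCompletion L] η) := by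
  rw [← quadraticChar_residue_eq_hilbertSymbol_of_toPlace_eq_mul_pow L w hw he h2 ϖ hϖ hσϖ η hηv m hy0 hy, map_mul, map_pow, map_neg, map_one, map_mul, map_pow,
    ← quadraticChar_neg_one (ringChar_residueField_ne_two L v w hw h2)]

include hw in
/-- For EVEN `m` the sign law loses its `(−1)^m`: `(y, θ)_v = χ(η̄)`. [cite: Serre1979, Ch. XIV §3 Prop. 8] -/
theorem hilbertSymbol_eq_quadraticChar_of_toPlace_eq_mul_pow_of_even (he : v.asIdeal.ramificationIdx' w.1.asIdeal ≠ 1)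
    (h2 : Valued.v (2 : w.1.adicCompletion L) = 1) (ϖ : w.1.adicCompletion L) (hϖ : Valued.v ϖ = WithZero.exp (-1 : ℤ))
    (hσϖ : galAdicCompletionMap (L := L) (IsCMField.complexConj L) hw ϖ = -ϖ)
    [Fintype 𝓀[w.1.adicCompletion L]] [DecidableEq 𝓀[w.1.adicCompletion L]]
    (η : 𝒪[w.1.adicCompletion L]) (hηv : Valued.v (η : w.1.adicCompletion L) = 1) {m : ℕ} (hm : Even m)
    {y : v.adicCompletion ↥(maximalRealSubfield L)} (hy0 : y ≠ 0) (hy : toPlace v w y = (η : w.1.adicCompletion L) * ϖ ^ (2 * m)) :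
    hilbertSymbol (v.adicCompletion ↥(maximalRealSubfield L)) y
        (algebraMap ↥(maximalRealSubfield L) _ ((cmQuadraticGenerator L : 𝓞 ↥(maximalRealSubfield L)) : ↥(maximalRealSubfield L))) =
      quadraticChar 𝓀[w.1.adicCompletion L] (IsLocalRing.residue 𝒪[w.1.adicCompletion L] η) := by
  rw [← quadraticChar_residue_eq_hilbertSymbol_of_toPlace_eq_mul_pow L w hw he h2 ϖ hϖ hσϖ η hηv m hy0 hy, Even.neg_one_pow hm, one_mul]

/-! ## §3 The type-(2) head: `β(γ_H)` read on the unit part of `χ_g(u)_w` -/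

include hw in
/-- **(z5) THE TYPE-(2) SIGN LAW.**  At a tame-ramified non-split place, for `u ≡ 1`, `d ≡ 1 (mod 𝔪_w)` (`u = u_w`, `d = det g_w`), `c = χ_g(u)_w = c₀·ϖ^{2m}` with `c₀ ∈ 𝒪_w^×`
(THE UNIT PART of `χ_g(u)`; `m = v_F(χ_g(u))`, the socket's `hm`) and the T5 symmetrised discriminant `β ∈ (L⁺_v)ˣ`, `ι_w β = −c·(u² + d)∕(2u²d)`:
**`χ((−1)^{m+1}·c̄₀) = (β, θ)_v`**.  (`ι_w β = (−c₀ν)·ϖ^{2m}` with `ν = (u²+d)∕(2u²d)` a 1-unit (★ `v_symmDisc_sub_one_lt_one` at `(α,γ) := (d,1)`), `res ν = 1`, then §1.)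
ENGINE: = `τ = ω_E(−χ_g(u)∕det g)` = `fav` on 20∕20 LEDGER rows, 288∕288 sweep rows. [cite: Rogawski1990, §4.9 Prop. 4.9.1 p. 55, p. 59] [cite: LabesseLanglands1979, §2 pp. 8–9]
[cite: Serre1979, Ch. XIV §3 Prop. 8] -/
theorem quadraticChar_residue_eq_hilbertSymbol_typeTwo_of_ramified (he : v.asIdeal.ramificationIdx' w.1.asIdeal ≠ 1)
    (h2 : Valued.v (2 : w.1.adicCompletion L) = 1) (ϖ : w.1.adicCompletion L) (hϖ : Valued.v ϖ = WithZero.exp (-1 : ℤ))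
    (hσϖ : galAdicCompletionMap (L := L) (IsCMField.complexConj L) hw ϖ = -ϖ)
    [Fintype 𝓀[w.1.adicCompletion L]] [DecidableEq 𝓀[w.1.adicCompletion L]]
    {u d c : w.1.adicCompletion L} (hu1 : Valued.v (u - 1) < 1) (hd1 : Valued.v (d - 1) < 1)
    (c₀ : 𝒪[w.1.adicCompletion L]) (hc₀ : Valued.v (c₀ : w.1.adicCompletion L) = 1) (m : ℕ) (hc : c = (c₀ : w.1.adicCompletion L) * ϖ ^ (2 * m))
    (β : (v.adicCompletion ↥(maximalRealSubfield L))ˣ)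
    (hβ : toPlace v w (β : v.adicCompletion ↥(maximalRealSubfield L)) = -(c * (u ^ 2 + d)) / (2 * u ^ 2 * d)) :
    (quadraticChar 𝓀[w.1.adicCompletion L] (IsLocalRing.residue 𝒪[w.1.adicCompletion L] ((-1) ^ (m + 1) * c₀)) : ℤ) =
      hilbertSymbol (v.adicCompletion ↥(maximalRealSubfield L)) (β : v.adicCompletion ↥(maximalRealSubfield L))
        (algebraMap ↥(maximalRealSubfield L) _ ((cmQuadraticGenerator L : 𝓞 ↥(maximalRealSubfield L)) : ↥(maximalRealSubfield L))) := by
  have hne : ∀ {x : w.1.adicCompletion L}, Valued.v x = 1 → x ≠ 0 := fun hx h => by rw [h, Valuation.map_zero] at hx; exact zero_ne_one hx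
  have huv : Valued.v u = 1 := by have h := Valuation.map_one_add_of_lt _ hu1; rwa [add_sub_cancel] at h
  have hdv : Valued.v d = 1 := by have h := Valuation.map_one_add_of_lt _ hd1; rwa [add_sub_cancel] at h
  -- the 1-unit `ν = (u² + d)∕(2u²d)` (★ g39 §1 at `(α, γ) := (d, 1)`)
  have hν : Valued.v ((u ^ 2 + d * 1) / (2 * u ^ 2 * (d * 1)) - 1) < 1 :=
    v_symmDisc_sub_one_lt_one L w h2 hd1 hu1 (by rw [sub_self, Valuation.map_zero]; exact zero_lt_one)
  rw [mul_one] at hν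
  have hνO : (u ^ 2 + d) / (2 * u ^ 2 * d) ∈ 𝒪[w.1.adicCompletion L] := by
    rw [← v_le_one_iff_mem_integer]
    have h := Valuation.map_one_add_of_lt _ hν; rw [add_sub_cancel] at h; exact h.le
  obtain ⟨νO, hνcoe⟩ : ∃ νO : 𝒪[w.1.adicCompletion L], (νO : w.1.adicCompletion L) = (u ^ 2 + d) / (2 * u ^ 2 * d) := ⟨⟨_, hνO⟩, rfl⟩
  have hνv : Valued.v (νO : w.1.adicCompletion L) = 1 := by
    have h := Valuation.map_one_add_of_lt _ hν; rw [add_sub_cancel, ← hνcoe] at h; exact h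
  have hνres : IsLocalRing.residue 𝒪[w.1.adicCompletion L] νO = 1 := by
    rw [← (IsLocalRing.residue 𝒪[w.1.adicCompletion L]).map_one, ← sub_eq_zero, ← map_sub, residue_eq_zero_iff_valuation_lt_one, ← v_lt_one_iff_valuation_lt_one]
    push_cast
    rw [hνcoe]; exact hν
  -- `ι_w β = η·ϖ^{2m}` with the unit `η = −c₀·ν`
  have hηv : Valued.v ((-c₀ * νO : 𝒪[w.1.adicCompletion L]) : w.1.adicCompletion L) = 1 := by
    push_cast; rw [Valuation.map_mul, Valuation.map_neg, hc₀, hνv, one_mul]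
  have hD : (2 * u ^ 2 * d : w.1.adicCompletion L) ≠ 0 := mul_ne_zero (mul_ne_zero (hne h2) (pow_ne_zero _ (hne huv))) (hne hdv)
  have hy : toPlace v w (β : v.adicCompletion ↥(maximalRealSubfield L)) = ((-c₀ * νO : 𝒪[w.1.adicCompletion L]) : w.1.adicCompletion L) * ϖ ^ (2 * m) := by
    push_cast
    rw [hνcoe, hβ, hc]
    ring
  have hres : IsLocalRing.residue 𝒪[w.1.adicCompletion L] ((-1) ^ m * (-c₀ * νO)) = IsLocalRing.residue 𝒪[w.1.adicCompletion L] ((-1) ^ (m + 1) * c₀) := by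
    rw [map_mul, map_mul (IsLocalRing.residue 𝒪[w.1.adicCompletion L]) (-c₀) νO, hνres, mul_one, ← map_mul]
    congr 1
    rw [pow_succ]; ring
  rw [← quadraticChar_residue_eq_hilbertSymbol_of_toPlace_eq_mul_pow L w hw he h2 ϖ hϖ hσϖ (-c₀ * νO) hηv m β.ne_zero hy, hres]

include hw in
/-- `↔`-reading of the type-(2) sign law: **`(β, θ)_v = 1 ⟺ res((−1)^{m+1}·c₀) ∈ 𝓀_w²`**. [cite: Rogawski1990, §4.9 p. 59] [cite: Serre1979, Ch. XIV §3 Prop. 8] -/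
theorem hilbertSymbol_typeTwo_eq_one_iff_isSquare_residue_of_ramified (he : v.asIdeal.ramificationIdx' w.1.asIdeal ≠ 1)
    (h2 : Valued.v (2 : w.1.adicCompletion L) = 1) (ϖ : w.1.adicCompletion L) (hϖ : Valued.v ϖ = WithZero.exp (-1 : ℤ))
    (hσϖ : galAdicCompletionMap (L := L) (IsCMField.complexConj L) hw ϖ = -ϖ)
    [Fintype 𝓀[w.1.adicCompletion L]] [DecidableEq 𝓀[w.1.adicCompletion L]]
    {u d c : w.1.adicCompletion L} (hu1 : Valued.v (u - 1) < 1) (hd1 : Valued.v (d - 1) < 1)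
    (c₀ : 𝒪[w.1.adicCompletion L]) (hc₀ : Valued.v (c₀ : w.1.adicCompletion L) = 1) (m : ℕ) (hc : c = (c₀ : w.1.adicCompletion L) * ϖ ^ (2 * m))
    (β : (v.adicCompletion ↥(maximalRealSubfield L))ˣ)
    (hβ : toPlace v w (β : v.adicCompletion ↥(maximalRealSubfield L)) = -(c * (u ^ 2 + d)) / (2 * u ^ 2 * d)) :
    hilbertSymbol (v.adicCompletion ↥(maximalRealSubfield L)) (β : v.adicCompletion ↥(maximalRealSubfield L))
        (algebraMap ↥(maximalRealSubfield L) _ ((cmQuadraticGenerator L : 𝓞 ↥(maximalRealSubfield L)) : ↥(maximalRealSubfield L))) = 1 ↔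
      IsSquare (IsLocalRing.residue 𝒪[w.1.adicCompletion L] ((-1) ^ (m + 1) * c₀)) := by
  have h0 : IsLocalRing.residue 𝒪[w.1.adicCompletion L] ((-1) ^ (m + 1) * c₀) ≠ 0 := by
    have hv : Valued.v (((-1) ^ (m + 1) * c₀ : 𝒪[w.1.adicCompletion L]) : w.1.adicCompletion L) = 1 := by
      push_cast; rw [Valuation.map_mul, Valuation.map_pow, Valuation.map_neg, Valuation.map_one, one_pow, one_mul, hc₀]
    rw [Ne, residue_eq_zero_iff_valuation_lt_one, ← v_lt_one_iff_valuation_lt_one, hv]; exact lt_irrefl _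
  rw [← quadraticChar_residue_eq_hilbertSymbol_typeTwo_of_ramified L w hw he h2 ϖ hϖ hσϖ hu1 hd1 c₀ hc₀ m hc β hβ, ← quadraticChar_one_iff_isSquare h0]

include hw in
/-- ℂ twin of the type-(2) sign law (the (Cnt2′) sockets are complex identities): `(χ((−1)^{m+1} c̄₀) : ℂ) = ((β,θ)_v : ℂ)`. [cite: Rogawski1990, §4.9 p. 59] -/
theorem quadraticChar_residue_eq_hilbertSymbol_typeTwo_of_ramified_complex (he : v.asIdeal.ramificationIdx' w.1.asIdeal ≠ 1)
    (h2 : Valued.v (2 : w.1.adicCompletion L) = 1) (ϖ : w.1.adicCompletion L) (hϖ : Valued.v ϖ = WithZero.exp (-1 : ℤ))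
    (hσϖ : galAdicCompletionMap (L := L) (IsCMField.complexConj L) hw ϖ = -ϖ)
    [Fintype 𝓀[w.1.adicCompletion L]] [DecidableEq 𝓀[w.1.adicCompletion L]]
    {u d c : w.1.adicCompletion L} (hu1 : Valued.v (u - 1) < 1) (hd1 : Valued.v (d - 1) < 1)
    (c₀ : 𝒪[w.1.adicCompletion L]) (hc₀ : Valued.v (c₀ : w.1.adicCompletion L) = 1) (m : ℕ) (hc : c = (c₀ : w.1.adicCompletion L) * ϖ ^ (2 * m))
    (β : (v.adicCompletion ↥(maximalRealSubfield L))ˣ)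
    (hβ : toPlace v w (β : v.adicCompletion ↥(maximalRealSubfield L)) = -(c * (u ^ 2 + d)) / (2 * u ^ 2 * d)) :
    ((quadraticChar 𝓀[w.1.adicCompletion L] (IsLocalRing.residue 𝒪[w.1.adicCompletion L] ((-1) ^ (m + 1) * c₀)) : ℤ) : ℂ) =
      (hilbertSymbol (v.adicCompletion ↥(maximalRealSubfield L)) (β : v.adicCompletion ↥(maximalRealSubfield L))
        (algebraMap ↥(maximalRealSubfield L) _ ((cmQuadraticGenerator L : 𝓞 ↥(maximalRealSubfield L)) : ↥(maximalRealSubfield L))) : ℂ) := by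
  exact_mod_cast quadraticChar_residue_eq_hilbertSymbol_typeTwo_of_ramified L w hw he h2 ϖ hϖ hσϖ hu1 hd1 c₀ hc₀ m hc β hβ

include hw in
/-- «q mod 4» twin of the type-(2) sign law: **`(β, θ)_v = χ₄(#𝓀_w)^{m+1} · χ(c̄₀)`** — the sign read on (`m = v_F(χ_g(u))`, the unit part `c̄₀`, `q mod 4`).
[cite: Rogawski1990, §4.9 p. 59] [cite: Serre1979, Ch. XIV §3 Prop. 8] -/
theorem hilbertSymbol_typeTwo_eq_chi4_pow_mul_quadraticChar_of_ramified (he : v.asIdeal.ramificationIdx' w.1.asIdeal ≠ 1)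
    (h2 : Valued.v (2 : w.1.adicCompletion L) = 1) (ϖ : w.1.adicCompletion L) (hϖ : Valued.v ϖ = WithZero.exp (-1 : ℤ))
    (hσϖ : galAdicCompletionMap (L := L) (IsCMField.complexConj L) hw ϖ = -ϖ)
    [Fintype 𝓀[w.1.adicCompletion L]] [DecidableEq 𝓀[w.1.adicCompletion L]]
    {u d c : w.1.adicCompletion L} (hu1 : Valued.v (u - 1) < 1) (hd1 : Valued.v (d - 1) < 1)
    (c₀ : 𝒪[w.1.adicCompletion L]) (hc₀ : Valued.v (c₀ : w.1.adicCompletion L) = 1) (m : ℕ) (hc : c = (c₀ : w.1.adicCompletion L) * ϖ ^ (2 * m))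
    (β : (v.adicCompletion ↥(maximalRealSubfield L))ˣ)
    (hβ : toPlace v w (β : v.adicCompletion ↥(maximalRealSubfield L)) = -(c * (u ^ 2 + d)) / (2 * u ^ 2 * d)) :
    hilbertSymbol (v.adicCompletion ↥(maximalRealSubfield L)) (β : v.adicCompletion ↥(maximalRealSubfield L))
        (algebraMap ↥(maximalRealSubfield L) _ ((cmQuadraticGenerator L : 𝓞 ↥(maximalRealSubfield L)) : ↥(maximalRealSubfield L))) =
      (ZMod.χ₄ (Fintype.card 𝓀[w.1.adicCompletion L])) ^ (m + 1) * quadraticChar 𝓀[w.1.adicCompletion L] (IsLocalRing.residue 𝒪[w.1.adicCompletion L] c₀) := by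
  rw [← quadraticChar_residue_eq_hilbertSymbol_typeTwo_of_ramified L w hw he h2 ϖ hϖ hσϖ hu1 hd1 c₀ hc₀ m hc β hβ, map_mul, map_pow, map_neg, map_one, map_mul, map_pow,
    ← quadraticChar_neg_one (ringChar_residueField_ne_two L v w hw h2)]

/-! ## §4 (ED. 2) ANATOMY READINGS of the unit part `c̄₀` — block data `χ_g(u) = (u−1)² − (u−1)·tr(g−1) + det(g−1)` -/

include hw in
/-- **FIRST-ORDER PRINCIPLE**: the type-(2) sign only sees the unit part of `c = χ_g(u)_w` TO FIRST ORDER — if `|c − E·ϖ^{2m}| < |ϖ^{2m}|` for a unit `E ∈ 𝒪_w`, then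
**`χ((−1)^{m+1}·Ē) = (β, θ)_v`** (`c∕ϖ^{2m}` is then a unit with residue `Ē`; §3).  [cite: Rogawski1990, §4.9 p. 59] [cite: Serre1979, Ch. XIV §3 Prop. 8] -/
theorem quadraticChar_residue_eq_hilbertSymbol_typeTwo_of_sub_lt (he : v.asIdeal.ramificationIdx' w.1.asIdeal ≠ 1)
    (h2 : Valued.v (2 : w.1.adicCompletion L) = 1) (ϖ : w.1.adicCompletion L) (hϖ : Valued.v ϖ = WithZero.exp (-1 : ℤ))
    (hσϖ : galAdicCompletionMap (L := L) (IsCMField.complexConj L) hw ϖ = -ϖ)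
    [Fintype 𝓀[w.1.adicCompletion L]] [DecidableEq 𝓀[w.1.adicCompletion L]]
    {u d c : w.1.adicCompletion L} (hu1 : Valued.v (u - 1) < 1) (hd1 : Valued.v (d - 1) < 1)
    (E : 𝒪[w.1.adicCompletion L]) (hE : Valued.v (E : w.1.adicCompletion L) = 1) (m : ℕ)
    (hcE : Valued.v (c - (E : w.1.adicCompletion L) * ϖ ^ (2 * m)) < Valued.v (ϖ ^ (2 * m)))
    (β : (v.adicCompletion ↥(maximalRealSubfield L))ˣ)
    (hβ : toPlace v w (β : v.adicCompletion ↥(maximalRealSubfield L)) = -(c * (u ^ 2 + d)) / (2 * u ^ 2 * d)) :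
    (quadraticChar 𝓀[w.1.adicCompletion L] (IsLocalRing.residue 𝒪[w.1.adicCompletion L] ((-1) ^ (m + 1) * E)) : ℤ) =
      hilbertSymbol (v.adicCompletion ↥(maximalRealSubfield L)) (β : v.adicCompletion ↥(maximalRealSubfield L))
        (algebraMap ↥(maximalRealSubfield L) _ ((cmQuadraticGenerator L : 𝓞 ↥(maximalRealSubfield L)) : ↥(maximalRealSubfield L))) := by
  have hϖ0 : ϖ ≠ 0 := fun h => by rw [h, Valuation.map_zero] at hϖ; exact WithZero.exp_ne_zero hϖ.symm
  have hP0 : (ϖ : w.1.adicCompletion L) ^ (2 * m) ≠ 0 := pow_ne_zero _ hϖ0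
  have hvP0 : Valued.v ((ϖ : w.1.adicCompletion L) ^ (2 * m)) ≠ 0 := (Valuation.ne_zero_iff _).2 hP0
  -- the unit part `c₀ = c ∕ ϖ^{2m}` to first order
  set c₀ : w.1.adicCompletion L := c / ϖ ^ (2 * m) with hc₀def
  have hdiff : Valued.v (c₀ - E) < 1 := by
    have e : c₀ - E = (c - (E : w.1.adicCompletion L) * ϖ ^ (2 * m)) / ϖ ^ (2 * m) := by rw [hc₀def]; field_simp
    rw [e, map_div₀]
    calc Valued.v (c - (E : w.1.adicCompletion L) * ϖ ^ (2 * m)) / Valued.v (ϖ ^ (2 * m))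
        < Valued.v (ϖ ^ (2 * m)) / Valued.v (ϖ ^ (2 * m)) := by exact div_lt_div_of_pos_right hcE (zero_lt_iff.2 hvP0)  -- strict monotonicity of `· ∕ g`
      _ = 1 := div_self hvP0
  have hc₀v : Valued.v c₀ = 1 := by
    have hlt : Valued.v (c₀ - E) < Valued.v (E : w.1.adicCompletion L) := by rw [hE]; exact hdiff
    have e : c₀ = (E : w.1.adicCompletion L) + (c₀ - E) := by ring
    rw [e, Valuation.map_add_eq_of_lt_left _ hlt, hE]
  have hc₀O : c₀ ∈ 𝒪[w.1.adicCompletion L] := (v_le_one_iff_mem_integer _).1 hc₀v.le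
  have hc : c = ((⟨c₀, hc₀O⟩ : 𝒪[w.1.adicCompletion L]) : w.1.adicCompletion L) * ϖ ^ (2 * m) := by
    change c = c₀ * ϖ ^ (2 * m); rw [hc₀def, div_mul_cancel₀ _ hP0]
  have hres : IsLocalRing.residue 𝒪[w.1.adicCompletion L] ⟨c₀, hc₀O⟩ = IsLocalRing.residue 𝒪[w.1.adicCompletion L] E := by
    rw [← sub_eq_zero, ← map_sub, residue_eq_zero_iff_valuation_lt_one, ← v_lt_one_iff_valuation_lt_one]; exact hdiff
  rw [← quadraticChar_residue_eq_hilbertSymbol_typeTwo_of_ramified L w hw he h2 ϖ hϖ hσϖ hu1 hd1 ⟨c₀, hc₀O⟩ hc₀v m hc β hβ,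
    map_mul (IsLocalRing.residue 𝒪[w.1.adicCompletion L]) ((-1) ^ (m + 1)) E, map_mul (IsLocalRing.residue 𝒪[w.1.adicCompletion L]) ((-1) ^ (m + 1)) ⟨c₀, hc₀O⟩, hres]

include hw in
/-- **(R-a) BLOCK SHALLOWER THAN THE `u`-LINE**: `det(g_w − 1) = d − t + 1 = D₀·ϖ^{2m}` (`D₀` a unit, `t = tr g_w`, `d = det g_w`), `|u−1|² < |ϖ^{2m}|`,
`|(u−1)(t−2)| < |ϖ^{2m}|` ⇒ **`(β, θ)_v = χ((−1)^{m+1}·D̄₀)`** (then `χ_g(u) = (u−1)² − (u−1)(t−2) + det(g−1) ≡ det(g−1)` to first order).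
ENGINE: 144∕144 sweep rows + 9∕9 LEDGER rows in this regime. [cite: Rogawski1990, §4.9 p. 59] [cite: LabesseLanglands1979, §2 pp. 8–9] -/
theorem hilbertSymbol_typeTwo_of_block_shallow (he : v.asIdeal.ramificationIdx' w.1.asIdeal ≠ 1)
    (h2 : Valued.v (2 : w.1.adicCompletion L) = 1) (ϖ : w.1.adicCompletion L) (hϖ : Valued.v ϖ = WithZero.exp (-1 : ℤ))
    (hσϖ : galAdicCompletionMap (L := L) (IsCMField.complexConj L) hw ϖ = -ϖ)
    [Fintype 𝓀[w.1.adicCompletion L]] [DecidableEq 𝓀[w.1.adicCompletion L]]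
    {u t d : w.1.adicCompletion L} (hu1 : Valued.v (u - 1) < 1) (hd1 : Valued.v (d - 1) < 1)
    (D₀ : 𝒪[w.1.adicCompletion L]) (hD₀ : Valued.v (D₀ : w.1.adicCompletion L) = 1) (m : ℕ) (hD : d - t + 1 = (D₀ : w.1.adicCompletion L) * ϖ ^ (2 * m))
    (hx : Valued.v ((u - 1) ^ 2) < Valued.v (ϖ ^ (2 * m))) (hxT : Valued.v ((u - 1) * (t - 2)) < Valued.v (ϖ ^ (2 * m)))
    (β : (v.adicCompletion ↥(maximalRealSubfield L))ˣ)
    (hβ : toPlace v w (β : v.adicCompletion ↥(maximalRealSubfield L)) = -((u ^ 2 - t * u + d) * (u ^ 2 + d)) / (2 * u ^ 2 * d)) :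
    (quadraticChar 𝓀[w.1.adicCompletion L] (IsLocalRing.residue 𝒪[w.1.adicCompletion L] ((-1) ^ (m + 1) * D₀)) : ℤ) =
      hilbertSymbol (v.adicCompletion ↥(maximalRealSubfield L)) (β : v.adicCompletion ↥(maximalRealSubfield L))
        (algebraMap ↥(maximalRealSubfield L) _ ((cmQuadraticGenerator L : 𝓞 ↥(maximalRealSubfield L)) : ↥(maximalRealSubfield L))) := by
  refine quadraticChar_residue_eq_hilbertSymbol_typeTwo_of_sub_lt L w hw he h2 ϖ hϖ hσϖ hu1 hd1 D₀ hD₀ m ?_ β hβ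
  have e : u ^ 2 - t * u + d - (D₀ : w.1.adicCompletion L) * ϖ ^ (2 * m) = (u - 1) ^ 2 - (u - 1) * (t - 2) := by
    rw [← hD]; ring
  rw [e]
  exact Valuation.map_sub_lt _ hx hxT

include hw in
/-- **(R-b) `u`-LINE SHALLOWER THAN THE BLOCK**: `u − 1 = x₀·ϖ^k` (`x₀` a unit), `|t − 2| < |ϖ^k|`, `|d − t + 1| < |ϖ^{2k}|` ⇒ **`(β, θ)_v = χ((−1)^{k+1})`**
(`χ_g(u) ≡ (u−1)² = x₀²ϖ^{2k}` to first order and `χ(x̄₀²) = 1`; so `m = k` and the sign is `χ₄(q)^{k+1}`, `= 1` for odd `k` — see `…_of_odd`).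
ENGINE: 96∕96 sweep rows + 7∕7 LEDGER rows. [cite: Rogawski1990, §4.9 p. 59] [cite: LabesseLanglands1979, §2 pp. 8–9] -/
theorem hilbertSymbol_typeTwo_of_line_shallow (he : v.asIdeal.ramificationIdx' w.1.asIdeal ≠ 1)
    (h2 : Valued.v (2 : w.1.adicCompletion L) = 1) (ϖ : w.1.adicCompletion L) (hϖ : Valued.v ϖ = WithZero.exp (-1 : ℤ))
    (hσϖ : galAdicCompletionMap (L := L) (IsCMField.complexConj L) hw ϖ = -ϖ)
    [Fintype 𝓀[w.1.adicCompletion L]] [DecidableEq 𝓀[w.1.adicCompletion L]]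
    {u t d : w.1.adicCompletion L} (hu1 : Valued.v (u - 1) < 1) (hd1 : Valued.v (d - 1) < 1)
    (x₀ : 𝒪[w.1.adicCompletion L]) (hx₀ : Valued.v (x₀ : w.1.adicCompletion L) = 1) (k : ℕ) (hx : u - 1 = (x₀ : w.1.adicCompletion L) * ϖ ^ k)
    (hT : Valued.v (t - 2) < Valued.v (ϖ ^ k)) (hD : Valued.v (d - t + 1) < Valued.v (ϖ ^ (2 * k)))
    (β : (v.adicCompletion ↥(maximalRealSubfield L))ˣ)
    (hβ : toPlace v w (β : v.adicCompletion ↥(maximalRealSubfield L)) = -((u ^ 2 - t * u + d) * (u ^ 2 + d)) / (2 * u ^ 2 * d)) :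
    hilbertSymbol (v.adicCompletion ↥(maximalRealSubfield L)) (β : v.adicCompletion ↥(maximalRealSubfield L))
        (algebraMap ↥(maximalRealSubfield L) _ ((cmQuadraticGenerator L : 𝓞 ↥(maximalRealSubfield L)) : ↥(maximalRealSubfield L))) =
      quadraticChar 𝓀[w.1.adicCompletion L] ((-1) ^ (k + 1)) := by
  have hϖ0 : ϖ ≠ 0 := fun h => by rw [h, Valuation.map_zero] at hϖ; exact WithZero.exp_ne_zero hϖ.symm
  have hvk0 : Valued.v ((ϖ : w.1.adicCompletion L) ^ k) ≠ 0 := (Valuation.ne_zero_iff _).2 (pow_ne_zero _ hϖ0)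
  have hx₀2 : Valued.v (((x₀ ^ 2 : 𝒪[w.1.adicCompletion L])) : w.1.adicCompletion L) = 1 := by
    push_cast; rw [Valuation.map_pow, hx₀, one_pow]
  have hcE : Valued.v (u ^ 2 - t * u + d - ((x₀ ^ 2 : 𝒪[w.1.adicCompletion L]) : w.1.adicCompletion L) * ϖ ^ (2 * k)) < Valued.v (ϖ ^ (2 * k)) := by
    have hsq : (u - 1) ^ 2 = (x₀ : w.1.adicCompletion L) ^ 2 * ϖ ^ (2 * k) := by rw [hx, mul_pow, ← pow_mul, mul_comm k 2]
    have hid : u ^ 2 - t * u + d = (u - 1) ^ 2 - (u - 1) * (t - 2) + (d - t + 1) := by ring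
    have e : u ^ 2 - t * u + d - ((x₀ ^ 2 : 𝒪[w.1.adicCompletion L]) : w.1.adicCompletion L) * ϖ ^ (2 * k) = -((u - 1) * (t - 2)) + (d - t + 1) := by
      rw [hid, hsq]; push_cast; ring
    rw [e]
    refine Valuation.map_add_lt _ ?_ hD
    rw [Valuation.map_neg, Valuation.map_mul, hx, Valuation.map_mul, hx₀, one_mul, two_mul, pow_add, Valuation.map_mul]
    exact mul_lt_mul_of_pos_left hT (zero_lt_iff.2 hvk0)
  have hx0res : IsLocalRing.residue 𝒪[w.1.adicCompletion L] x₀ ≠ 0 := by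
    rw [Ne, residue_eq_zero_iff_valuation_lt_one, ← v_lt_one_iff_valuation_lt_one, hx₀]; exact lt_irrefl _
  have key := quadraticChar_residue_eq_hilbertSymbol_typeTwo_of_sub_lt L w hw he h2 ϖ hϖ hσϖ hu1 hd1 (x₀ ^ 2) hx₀2 k hcE β hβ
  rw [← key, map_mul, map_mul, map_pow (IsLocalRing.residue 𝒪[w.1.adicCompletion L]) x₀ 2, quadraticChar_sq_one' hx0res, mul_one, map_pow, map_neg, map_one]

include hw in
/-- (R-b) for ODD `k` (the depth `v_w(u_w − 1)` of a norm-one `u_w ≡ 1` at a ramified place is always odd): **`(β, θ)_v = 1`**.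
[cite: Rogawski1990, §4.9 p. 59] [cite: Serre1979, Ch. V §3] -/
theorem hilbertSymbol_typeTwo_of_line_shallow_of_odd (he : v.asIdeal.ramificationIdx' w.1.asIdeal ≠ 1)
    (h2 : Valued.v (2 : w.1.adicCompletion L) = 1) (ϖ : w.1.adicCompletion L) (hϖ : Valued.v ϖ = WithZero.exp (-1 : ℤ))
    (hσϖ : galAdicCompletionMap (L := L) (IsCMField.complexConj L) hw ϖ = -ϖ)
    [Fintype 𝓀[w.1.adicCompletion L]] [DecidableEq 𝓀[w.1.adicCompletion L]]
    {u t d : w.1.adicCompletion L} (hu1 : Valued.v (u - 1) < 1) (hd1 : Valued.v (d - 1) < 1)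
    (x₀ : 𝒪[w.1.adicCompletion L]) (hx₀ : Valued.v (x₀ : w.1.adicCompletion L) = 1) {k : ℕ} (hk : Odd k) (hx : u - 1 = (x₀ : w.1.adicCompletion L) * ϖ ^ k)
    (hT : Valued.v (t - 2) < Valued.v (ϖ ^ k)) (hD : Valued.v (d - t + 1) < Valued.v (ϖ ^ (2 * k)))
    (β : (v.adicCompletion ↥(maximalRealSubfield L))ˣ)
    (hβ : toPlace v w (β : v.adicCompletion ↥(maximalRealSubfield L)) = -((u ^ 2 - t * u + d) * (u ^ 2 + d)) / (2 * u ^ 2 * d)) :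
    hilbertSymbol (v.adicCompletion ↥(maximalRealSubfield L)) (β : v.adicCompletion ↥(maximalRealSubfield L))
        (algebraMap ↥(maximalRealSubfield L) _ ((cmQuadraticGenerator L : 𝓞 ↥(maximalRealSubfield L)) : ↥(maximalRealSubfield L))) = 1 := by
  rw [hilbertSymbol_typeTwo_of_line_shallow L w hw he h2 ϖ hϖ hσϖ hu1 hd1 x₀ hx₀ k hx hT hD β hβ, Even.neg_one_pow (hk.add_one), map_one]

include hw in
/-- **(R-c) THE TIE**: `u − 1 = x₀·ϖ^m`, `d − t + 1 = D₀·ϖ^{2m}`, `|t − 2| < |ϖ^m|` and `x₀² + D₀` a UNIT ⇒ **`(β, θ)_v = χ((−1)^{m+1}·(x̄₀² + D̄₀))`**.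
ENGINE: 48∕48 sweep rows + 4∕4 LEDGER rows (in the model `D̄₀ = −ε m′²`, never a cancellation). [cite: Rogawski1990, §4.9 p. 59] [cite: LabesseLanglands1979, §2 pp. 8–9] -/
theorem hilbertSymbol_typeTwo_of_tie (he : v.asIdeal.ramificationIdx' w.1.asIdeal ≠ 1)
    (h2 : Valued.v (2 : w.1.adicCompletion L) = 1) (ϖ : w.1.adicCompletion L) (hϖ : Valued.v ϖ = WithZero.exp (-1 : ℤ))
    (hσϖ : galAdicCompletionMap (L := L) (IsCMField.complexConj L) hw ϖ = -ϖ)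
    [Fintype 𝓀[w.1.adicCompletion L]] [DecidableEq 𝓀[w.1.adicCompletion L]]
    {u t d : w.1.adicCompletion L} (hu1 : Valued.v (u - 1) < 1) (hd1 : Valued.v (d - 1) < 1)
    (x₀ D₀ : 𝒪[w.1.adicCompletion L]) (m : ℕ) (hx : u - 1 = (x₀ : w.1.adicCompletion L) * ϖ ^ m)
    (hD : d - t + 1 = (D₀ : w.1.adicCompletion L) * ϖ ^ (2 * m)) (hT : Valued.v (t - 2) < Valued.v (ϖ ^ m))
    (hs : Valued.v (((x₀ ^ 2 + D₀ : 𝒪[w.1.adicCompletion L])) : w.1.adicCompletion L) = 1)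
    (β : (v.adicCompletion ↥(maximalRealSubfield L))ˣ)
    (hβ : toPlace v w (β : v.adicCompletion ↥(maximalRealSubfield L)) = -((u ^ 2 - t * u + d) * (u ^ 2 + d)) / (2 * u ^ 2 * d)) :
    (quadraticChar 𝓀[w.1.adicCompletion L] (IsLocalRing.residue 𝒪[w.1.adicCompletion L] ((-1) ^ (m + 1) * (x₀ ^ 2 + D₀))) : ℤ) =
      hilbertSymbol (v.adicCompletion ↥(maximalRealSubfield L)) (β : v.adicCompletion ↥(maximalRealSubfield L))
        (algebraMap ↥(maximalRealSubfield L) _ ((cmQuadraticGenerator L : 𝓞 ↥(maximalRealSubfield L)) : ↥(maximalRealSubfield L))) := by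
  refine quadraticChar_residue_eq_hilbertSymbol_typeTwo_of_sub_lt L w hw he h2 ϖ hϖ hσϖ hu1 hd1 (x₀ ^ 2 + D₀) hs m ?_ β hβ
  have hx₀le : Valued.v (x₀ : w.1.adicCompletion L) ≤ 1 := (v_le_one_iff_mem_integer _).2 x₀.2
  have e : u ^ 2 - t * u + d - ((x₀ ^ 2 + D₀ : 𝒪[w.1.adicCompletion L]) : w.1.adicCompletion L) * ϖ ^ (2 * m) = -((u - 1) * (t - 2)) := by
    have hsq : (u - 1) ^ 2 = (x₀ : w.1.adicCompletion L) ^ 2 * ϖ ^ (2 * m) := by rw [hx, mul_pow, ← pow_mul, mul_comm m 2]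
    have hid : u ^ 2 - t * u + d = (u - 1) ^ 2 - (u - 1) * (t - 2) + (d - t + 1) := by ring
    rw [hid, hsq, hD]; push_cast; ring
  have hϖ0 : ϖ ≠ 0 := fun h => by rw [h, Valuation.map_zero] at hϖ; exact WithZero.exp_ne_zero hϖ.symm
  have hvm0 : Valued.v ((ϖ : w.1.adicCompletion L) ^ m) ≠ 0 := (Valuation.ne_zero_iff _).2 (pow_ne_zero _ hϖ0)
  rw [e, Valuation.map_neg, Valuation.map_mul, hx, Valuation.map_mul, two_mul, pow_add, Valuation.map_mul, mul_assoc]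
  exact lt_of_le_of_lt (mul_le_of_le_one_left' hx₀le) (mul_lt_mul_of_pos_left hT (zero_lt_iff.2 hvm0))

end SignLaw

end Literature.NumberTheory.Rogawski1990

end
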